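import Literature.AnabelianGeometry.SemiGraphs.ApproximatorBridgeProofs
import HarnessLib

/-!
# [SemiAnbd] §2/§3: the two presentations — quasi-coherence (Def. 2.3 (iii) p. 25)

Mochizuki, *Semi-graphs of anabelioids*, Publ. RIMS **42** (2006), Def. 2.3 (iii) p. 25
[cite: MochizukiSemiAnbd2006, Def 2.3(iii) p.25]: `𝒢` is quasi-coherent if every bounded
collection of finite étale coverings of its constituents is split by some approximator.  The §3
rendering (`ProfiniteSemiGraph.IsQuasiCoherent`: finite `Π_v`-sets and `Π_e`-sets of cardinality `≤ M`,
split by the kernels of `Π_c → F_c`) implies the §2 rendering (`SemiGraphOfAnabelioids.IsQuasiCoherent`: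
basepoints, open subgroups of index `≤ M`, `Ker π₁(φ_c) ⊆ U_c`) for `𝒢.toAnab`
(`isQuasiCoherent_toAnab`): transport each `U_c ⊆ Aut F_c` to `Π_c` along the identification `θ_c`
of `exists_continuousMulEquiv_ker` (chosen BEFORE the approximator), take the coset objects
`Π_c / θ_c(U_c)`, apply §3 quasi-coherence, and read the §3 approximator as a §2 one
(`ApproximatorBridgeProofs.lean`).  Proof-only file.
-/

noncomputable section

namespace Literature.AnabelianGeometry.SemiGraphs

open CategoryTheory CategoryTheory.Limits CategoryTheory.PreGaloisCategory
open Literature.AnabelianGeometry.Anabelioids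
open Literature.AlgebraicGeometry.Frobenioids (BCat)
open scoped FintypeCatDiscrete Pointwise
open Induction

universe u

namespace ProfiniteSemiGraph

variable (𝒢 : ProfiniteSemiGraph.{u})

/-- **§3 quasi-coherent ⇒ §2 quasi-coherent** (for `𝒢` of injective type).
[cite: MochizukiSemiAnbd2006, Def 2.3(iii) p.25] -/
theorem isQuasiCoherent_toAnab (hinj : 𝒢.IsOfInjectiveType) (h : 𝒢.IsQuasiCoherent) :
    𝒢.toAnab.IsQuasiCoherent := by
  classical
  refine ⟨(𝒢.isOfInjectiveType_toAnab_iff).mpr hinj, fun M hM 𝒞 => ?_⟩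
  -- the basepoints and subgroups of `𝒞`, retyped over `BCat` (same terms)
  let FVb : ∀ v : 𝒢.graph.Vertex, BCat (𝒢.Gv v) ⥤ FintypeCat.{u} := fun v => 𝒞.FV v
  let FEb : ∀ e : 𝒢.graph.Edge, BCat (𝒢.Ge e) ⥤ FintypeCat.{u} := fun e => 𝒞.FE e
  have fibV : ∀ v, (letI := galoisCategory_bCat (𝒢.Gv v); FiberFunctor (FVb v)) :=
    fun v => 𝒞.fiberV v
  have fibE : ∀ e, (letI := galoisCategory_bCat (𝒢.Ge e); FiberFunctor (FEb e)) :=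
    fun e => 𝒞.fiberE e
  let UVa : ∀ v, Subgroup (Aut (FVb v)) := fun v => 𝒞.UV v
  let UEa : ∀ e, Subgroup (Aut (FEb e)) := fun e => 𝒞.UE e
  have hUVa_open : ∀ v, IsOpen (UVa v : Set (Aut (FVb v))) := fun v => 𝒞.isOpen_UV v
  have hUEa_open : ∀ e, IsOpen (UEa e : Set (Aut (FEb e))) := fun e => 𝒞.isOpen_UE e
  have hUVa_index : ∀ v, (UVa v).index ≤ M := fun v => 𝒞.index_UV v
  have hUEa_index : ∀ e, (UEa e).index ≤ M := fun e => 𝒞.index_UE e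
  -- identifications `Aut (F_v) ≃ₜ* Π_v`, `Aut (F_e) ≃ₜ* Π_e` computing kernels, chosen now
  have hV := fun v : 𝒢.graph.Vertex =>
    @exists_continuousMulEquiv_ker (𝒢.Gv v) _ _ (𝒢.isTopologicalGroupV v) (𝒢.compactSpaceV v)
      (𝒢.totallyDisconnectedSpaceV v) (FVb v) (fibV v)
  have hE := fun e : 𝒢.graph.Edge =>
    @exists_continuousMulEquiv_ker (𝒢.Ge e) _ _ (𝒢.isTopologicalGroupE e) (𝒢.compactSpaceE e)
      (𝒢.totallyDisconnectedSpaceE e) (FEb e) (fibE e)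
  choose θV hθV using hV
  choose θE hθE using hE
  -- the transported open subgroups and their coset objects
  let UV : ∀ v, Subgroup (𝒢.Gv v) := fun v => (UVa v).map (θV v).toMonoidHom
  let UE : ∀ e, Subgroup (𝒢.Ge e) := fun e => (UEa e).map (θE e).toMonoidHom
  have hUVo : ∀ v, IsOpen (UV v : Set (𝒢.Gv v)) := fun v => by
    change IsOpen ((θV v) '' (UVa v : Set (Aut (FVb v))))
    exact (θV v).toHomeomorph.isOpenMap _ (hUVa_open v)
  have hUEo : ∀ e, IsOpen (UE e : Set (𝒢.Ge e)) := fun e => by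
    change IsOpen ((θE e) '' (UEa e : Set (Aut (FEb e))))
    exact (θE e).toHomeomorph.isOpenMap _ (hUEa_open e)
  haveI hUVf : ∀ v, Finite (𝒢.Gv v ⧸ UV v) := fun v =>
    Subgroup.quotient_finite_of_isOpen _ (hUVo v)
  haveI hUEf : ∀ e, Finite (𝒢.Ge e ⧸ UE e) := fun e =>
    Subgroup.quotient_finite_of_isOpen _ (hUEo e)
  let HV : ∀ v, BTemp (𝒢.Gv v) := fun v => (toBTemp (𝒢.Gv v)).obj (quotObj (UV v) (hUVo v))
  let HE : ∀ e, BTemp (𝒢.Ge e) := fun e => (toBTemp (𝒢.Ge e)).obj (quotObj (UE e) (hUEo e))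
  have hHV : ∀ v, Nat.card (HV v).obj.V ≤ M ∧ Finite (HV v).obj.V := fun v => by
    refine ⟨?_, hUVf v⟩
    change (UV v).index ≤ M
    rw [Subgroup.index_map_of_bijective (θV v).bijective]
    exact hUVa_index v
  have hHE : ∀ e, Nat.card (HE e).obj.V ≤ M ∧ Finite (HE e).obj.V := fun e => by
    refine ⟨?_, hUEf e⟩
    change (UE e).index ≤ M
    rw [Subgroup.index_map_of_bijective (θE e).bijective]
    exact hUEa_index e
  -- §3 quasi-coherence
  obtain ⟨A, hAV, hAE⟩ := h M HV HE hHV hHE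
  refine ⟨A.toProfinite.toAnab, A.toHom.toAnab, A.toAnab_isApproximator, ?_, ?_⟩
  · intro v τ hτ
    rw [MonoidHom.mem_ker] at hτ
    have h1 : A.πV v (θV v τ) = 1 :=
      (@hθV v (A.toProfinite.Gv v) _ _ (A.toProfinite.isTopologicalGroupV v)
        (A.toProfinite.compactSpaceV v) (A.toProfinite.totallyDisconnectedSpaceV v)
        (A.toHom.hV v) τ).mp hτ
    have h2 := hAV v (θV v τ) h1 (basePt (UV v) (hUVo v))
    -- `θ τ` fixes the base point of `Π_v / U'_v`, i.e. lies in `U'_v`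
    have h3 : θV v τ ∈ UV v := by
      change (((θV v τ * 1 : 𝒢.Gv v)) : 𝒢.Gv v ⧸ UV v) = (((1 : 𝒢.Gv v)) : 𝒢.Gv v ⧸ UV v) at h2
      rw [mul_one, QuotientGroup.eq, mul_one, inv_mem_iff] at h2
      exact h2
    obtain ⟨σ, hσ, hστ⟩ := h3
    rwa [← (θV v).injective hστ]
  · intro e τ hτ
    rw [MonoidHom.mem_ker] at hτ
    have h1 : A.πE e (θE e τ) = 1 :=
      (@hθE e (A.toProfinite.Ge e) _ _ (A.toProfinite.isTopologicalGroupE e)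
        (A.toProfinite.compactSpaceE e) (A.toProfinite.totallyDisconnectedSpaceE e)
        (A.toHom.hE e) τ).mp hτ
    have h2 := hAE e (θE e τ) h1 (basePt (UE e) (hUEo e))
    have h3 : θE e τ ∈ UE e := by
      change (((θE e τ * 1 : 𝒢.Ge e)) : 𝒢.Ge e ⧸ UE e) = (((1 : 𝒢.Ge e)) : 𝒢.Ge e ⧸ UE e) at h2
      rw [mul_one, QuotientGroup.eq, mul_one, inv_mem_iff] at h2
      exact h2
    obtain ⟨σ, hσ, hστ⟩ := h3
    rwa [← (θE e).injective hστ]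

end ProfiniteSemiGraph

end Literature.AnabelianGeometry.SemiGraphs

end
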